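import Literature.MathematicalPhysics.QuantumFieldTheory.Balaban1983to89.B9Eq335ClassBridgePV1
import Literature.MathematicalPhysics.QuantumFieldTheory.Balaban1983to89.B9WalkLettersCoordsS

/-!
# `Balaban1983to89.B9Eq335CubeDomCoverP` — T. Bałaban, *Propagators for lattice gauge theories in a background field*, Commun. Math. Phys. **99** (1985)
# 389–434 [Balaban1985BackgroundPropagators] p. 409 («the cube □̃⁵ is contained in one of the cubes for which this condition [(3.35)] holds») AT W-a's
# LETTERS: the enlarged cube `□̃(c) = cubeDomY x c` of a cover cube `c = (j, β)`, together with its collar of torus sup-radius one big `j`-block, lies in ONE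
# cube of print's class (3.35) — the aligned cube of `10` big `j`-blocks cornered `4` big blocks below `β` — so (3.35) hands ONE gauge `u` and ONE small field
# `A` with `U^u = e^{iηA}` on all of it

statement-level skeleton of published theorems with citation tags; proofs where landed; nothing here is a claim about the Yang–Mills mass gap

THE PRINT (verbatim).  p. 409 L1–3: *«We have assumed that the number O(1) in the condition (3.35) can be taken as equal to 12, thus the cube □̃⁵ is contained in
one of the cubes for which this condition holds»*; p. 416 (proof of Thm 3.11): *«Let us consider G_□(U) and let us make a gauge transformation to the gauge in which
U = e^{iηA}, A small»*; p. 396 (3.35): *«for an arbitrary cube □ of the described above class, and for a configuration U there exists a gauge transformation u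
on □ such that U^u = e^{iηA} …»*.

WHY THIS FILE (cell context).  Row 17's local road (this seat g21–g22: `hGsqA ⇐ hloc ⇐ (iii)`, `Thm/…N06Row17LocalClauseAtPureGauge`) and the N10 lane's
localised inverse road (dag-n10-w3 OFFER-3, stations L1–L5: `hloc` on a chart ball around the pure gauges) meet in the composition «L5 + gauge covariance
(this seat's `posDefTr_padDeltaALocY_gaugeY_iff`) + node00-def-Y's FILE-40 locality (`OpsYDeltaALocalAgree`, INTENT-51) + (3.35)'s per-cube datum ⇒ `hloc` on
(3.35)».  Its GEOMETRIC half is print's tacit p. 409 step: every site the padded local operator `Δ_{a,□}` reads — the sites of `□̃(c)` and a collar around them —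
lies in ONE class cube, on which (3.35) provides ONE pair `(u, A)`.  def-Y: «the geometric inclusion is YOUR side» (pub-ymgap INBOX 2026-08-28 12:53Z).  This file
proves it at W-a's `cubeDomY` with a collar of one big block, and reads the (3.35) datum off print's class there.

THE ARGUMENT.  Let `c = (j, β)` be a cover cube (`B6Cover236MultiLevelBlocks.cubes`: an active big `j`-block, side `S = bigSide j = M_h·L^{j+1}` fine sites) and
`Q := torusCube c₀ (10·S)` with `c₀ = (β − 4)·S` (a corner on the big-`j`-grid, since `S ∣ N`).  (i) The witness site of `c` has level `j` and lies in `[βS, (β+1)S)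
⊂ Q`, so by `B9Eq335ClassBridgePV1`'s two-case argument (`levV1_window` at `n = 10`, `sepT j`) `(Q, j, 10)` or `(Q, j−1, 10L)` is a P-triple (`alignedTenCube_mem_cubeClassP_or`).
(ii) A site `z` of `□̃(c)` lies in a block `a ∈ QbigT c` whose representative is within `13S/4` of the centre `(β+½)S` modulo the period
(`B6Cover236QbigOverlapV1.window_and_congr_of_mem_QbigT`, levels `j−1…j+1`), and `z` is within the block side `L^{j+1} ≤ S/8` of that representative; a collar site
`w` within torus sup-distance `S` of `z` is therefore within `35S/8` of the centre, i.e. `w − c₀ ∈ (S/8, 71S/8) ⊂ [0, 10S)` modulo the period: `w ∈ Q`.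

WHAT IS PROVED (sorry-free; 0 `def`; lattice geometry and bookkeeping only — nothing of [B9] asserted).
* §1 ★ `alignedTenCube_mem_cubeClassP_or` (the bridge's §1 for ANY aligned corner: `x ∈ torusCube c₀ (10·S_j)`, `levV1 i x = j`, `1 ≤ j ≤ k`, `c ≤ 10` ⇒ `(Q, j, 10) ∈
  cubeClassP i c ∨ (Q, j−1, 10L) ∈ cubeClassP i c`).
* §2 `val_sub_intCast_lt_of_window` (torus-cube membership from an integer window), `abs_sub_rep_lt_of_blkOf_eq` (a site is within the block side of its block's
  representative), `exists_abs_sub_le_of_circAbs_le` (a `circAbs` bound is a bound modulo the period).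
* §3 ★★★ **`exists_cubeClassP_cubeDomY_collar`**: for every member `x`, cover cube `c` and threshold `cthr ≤ 10` there is `q ∈ cubeClassP x.toKIdx cthr` of index
  `j(c)` (size `10`) or `j(c) − 1` (size `10L`) containing every torus site within torus sup-distance `bigSide j(c)` of a site of `cubeDomY x c` — in particular
  `□̃(c)` itself (`cubeDomY_subset_cubeClassP`).
* §4 ★★ **`reg335Cube_cubeDomY_collar_of_reg335P`** — the (3.35) datum `Reg335Cube` (ONE gauge `u`, ONE field `A`, `U^u = e^{iηA}`, `|A| < C(Lʲη)⁻¹`, `|∇^ηA| <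
  C(Lʲη)⁻²`) ON THE WHOLE COLLAR of `□̃(c)` at the scale `L^{j(c)}η` with `C = 10L³·(M·α₀)`, from `(bg9KP 𝔸 G x.toKIdx).Reg335 cthr α₀ U` (`cthr ≤ 10`, `α₀ ≥ 0`);
  member form ★★ `reg335Cube_cubeDomY_collar_of_regYP335` (`bg9YP`, first sequence) and the `c35Y`-spelled corollary.
MODEL ∕ DECLARED READINGS.  W-a's `cubeDomY` (the sites of r03's `QbigT`), def-Y's classes BY NAME; the collar radius `S = bigSide j(c)` and the size `10` are
witnesses (print: «□̃⁵», «12»); the constant `10L³` is the bridge's.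
HONEST SCOPE.  Geometry + bookkeeping; the ANALYTIC inputs of Cor. 3.6 on (3.35) (the chart-ball positivity L5, the volume-uniform coercivity of `Δ_{a,□}(1)`) are
NOT touched; NOT a node discharge, NOT summit progress; count-neutral; nothing continuum ∕ OS ∕ mass gap ∕ Clay.  Cell `pub-ymgap` (HUMAN RULING D-0062), Track A
node N06 [B9], seat `pub-ymgap-dag-n06-j` (bundle F5 + the (3.35) coverage lineage; harness re-seat gen 23), 2026-08-28.  NEW file importing `B9Eq335ClassBridgePV1`
+ `B9WalkLettersCoordsS`; nothing landed is modified.  Net new unproved facts: 0.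
-/

namespace Literature.MathematicalPhysics.QuantumFieldTheory.Balaban1983to89.B9Eq335CubeDomCoverP

open Literature.MathematicalPhysics.QuantumFieldTheory.Balaban1983to89
open B6KLevelCensusIndexV1 B9BackgroundsKLevelV1 B6GlobalChartV1 Node00 B9BackgroundsKLevelV1P B9Eq335CoverageWindow B9Eq335ClassBridgePV1
open Literature.MathematicalPhysics.QuantumFieldTheory.Balaban1983to89.B6MultiLevelBoxOperator (bigSide N0)
open Literature.MathematicalPhysics.QuantumFieldTheory.Balaban1983to89.B6Geom246MultiLevelBox (bset blkOf coord_bounds)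
open Literature.MathematicalPhysics.QuantumFieldTheory.Balaban1983to89.B6Cover236MultiLevelBlocks (cubes wit lev_wit blk_wit)
open Literature.MathematicalPhysics.QuantumFieldTheory.Balaban1983to89.B6Cover236MultiLevelTorusBlocks (rep blkOf_rep)
open Literature.MathematicalPhysics.QuantumFieldTheory.Balaban1983to89.B4TorusKernel.MultiPeriod (circAbs abs_add_mul_centre)
open Literature.MathematicalPhysics.QuantumFieldTheory.Balaban1983to89.B4Reflection242 (blk boxDom)
open Literature.MathematicalPhysics.QuantumFieldTheory.Balaban1983to89.B9Eq335RegularityClasses (Reg335Cube)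
open Literature.MathematicalPhysics.QuantumFieldTheory.Balaban1983to89.LatticeNorms (scaleLen)
open Literature.MathematicalPhysics.QuantumFieldTheory.Balaban1983to89.B9PinMembersKLevelV1 (MemberY bg9Y)
open Literature.MathematicalPhysics.QuantumFieldTheory.Balaban1983to89.B9WalkLettersCoordsS (cubeDomY cubeBlksY four_le_P)
open Literature.MathematicalPhysics.QuantumFieldTheory.Balaban1983to89.B9Thm37CubeCoverCommutators (one_le_Mh_and_P)

/-! ## §1 The aligned 10-cube through a site of its own level is a cube of print's class -/

section Geometry

variable {d ℓ : ℕ} {hd : 1 ≤ d + 1} {hL : Odd (ℓ + 1) ∧ 1 < ℓ + 1} {b₀ b₁ : ℝ}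
variable (i : KIdx d ℓ hd hL b₀ b₁)

/-- ★ **ANY ALIGNED CUBE OF `10` BIG `j`-BLOCKS THROUGH A SITE OF LEVEL `j` IS A CUBE OF PRINT'S CLASS** (threshold `c ≤ 10`): with `Q := torusCube c₀ (10·S_j)`,
`S_j ∣ c₀`, `x ∈ Q`, `lev x = j ∈ [1, k]`, EITHER `(Q, j, 10) ∈ cubeClassP i c` (no site of level `j−1` in `Q`) OR `(Q, j−1, 10L) ∈ cubeClassP i c` (one occurs; then
none of level `j+1` by (2.2)) — `B9Eq335ClassBridgePV1.exists_cubeClassP_supset`'s argument for an arbitrary aligned corner.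
[cite: Balaban1985BackgroundPropagators, p.396 (the cube class, «≧ 10»), p.409 («□̃⁵ is contained in one of the cubes»); Balaban1984PropagatorsII, (2.2) p.224] -/
theorem alignedTenCube_mem_cubeClassP_or {c : ℝ} (hc : c ≤ 10) {j : ℕ} (hj1 : 1 ≤ j) (hjk : j ≤ i.k)
    (c₀ : Site (PV d ℓ i.m i.K hd hL) 0) (hc₀ : ∀ μ, bigSide ℓ i.Mh j ∣ (c₀ μ).val)
    {x : Site (PV d ℓ i.m i.K hd hL) 0} (hx : x ∈ torusCube c₀ (10 * bigSide ℓ i.Mh j)) (hxj : levV1 i x = j) :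
    (torusCube c₀ (10 * bigSide ℓ i.Mh j), j, 10) ∈ cubeClassP i c ∨
      (torusCube c₀ (10 * bigSide ℓ i.Mh j), j - 1, 10 * (ℓ + 1)) ∈ cubeClassP i c := by
  classical
  set S := bigSide ℓ i.Mh j with hSdef
  have hℓ : 4 ≤ ℓ := i.hℓ
  have hR : 2 * (ℓ + 1) ^ 2 ≤ i.R := i.hR2
  have h10R : 10 * (ℓ + 1) ≤ i.R := le_trans (by nlinarith) hR
  have hwin : ∀ y ∈ torusCube c₀ (10 * S), j ≤ levV1 i y + 1 ∧ levV1 i y ≤ j + 1 := by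
    intro y hy
    have hx' : x ∈ torusCube c₀ (10 * bigSide ℓ i.Mh (levV1 i x)) := by rw [hxj]; exact hx
    have hy' : y ∈ torusCube c₀ (10 * bigSide ℓ i.Mh (levV1 i x)) := by rw [hxj]; exact hy
    have h := levV1_window i h10R hx' hy'
    rw [hxj] at h
    exact h
  by_cases hlow : ∃ y ∈ torusCube c₀ (10 * S), levV1 i y + 1 = j
  · -- CASE B: index `j − 1`, size `10L`
    right
    obtain ⟨y, hy, hylev⟩ := hlow
    have hy1 : 1 ≤ levV1 i y := levV1_pos i y
    have hnoup : ∀ z ∈ torusCube c₀ (10 * S), levV1 i z ≤ j := by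
      intro z hz
      by_contra hzl
      push Not at hzl
      have hyl : i.D.lev (toBox i.hN y).1 = levV1 i y := rfl
      have hzl' : i.D.lev (toBox i.hN z).1 = levV1 i z := rfl
      have hsep := i.D.sepT j (toBox i.hN y).1 (toBox i.hN y).2 (toBox i.hN z).1 (toBox i.hN z).2
        (by rw [hyl]; omega) (by rw [hzl']; omega)
      have hd' := torusSupNorm_lt_of_mem_torusCube i hy hz
      have hlt : i.R * S < 10 * S := by exact_mod_cast lt_trans hsep hd'
      have : 10 ≤ i.R := le_trans (by nlinarith) h10R
      nlinarith
    have hS' : S = (ℓ + 1) * bigSide ℓ i.Mh (j - 1) := by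
      rw [hSdef]; unfold B6MultiLevelBoxOperator.bigSide
      rw [show j + 1 = (j - 1 + 1) + 1 by omega, pow_succ]; ring
    have hcube : torusCube c₀ (10 * S) = torusCube c₀ ((10 * (ℓ + 1)) * bigSide ℓ i.Mh (j - 1)) := by
      rw [hS']; ring_nf
    rw [hcube]
    refine alignedCube_mem_cubeClassP i (j := j - 1) (n := 10 * (ℓ + 1)) (by omega) (by omega) (by omega) ?_ c₀ ?_ ?_ ?_
    · calc c ≤ 10 := hc
        _ ≤ ((10 * (ℓ + 1) : ℕ) : ℝ) := by exact_mod_cast (by omega : 10 ≤ 10 * (ℓ + 1))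
    · intro κ
      exact dvd_trans (Dvd.intro_left _ hS'.symm) (hc₀ κ)
    · intro z hz
      rw [← hcube] at hz
      have h1 := hwin z hz
      have h2 := hnoup z hz
      omega
    · exact ⟨y, by rw [← hcube]; exact hy, by omega⟩
  · -- CASE A: index `j`, size `10`
    left
    push Not at hlow
    refine alignedCube_mem_cubeClassP i hj1 hjk (by norm_num) (by exact_mod_cast hc) c₀ hc₀ ?_ ⟨x, hx, hxj⟩
    intro z hz
    have h1 := hwin z hz
    have h2 := hlow z hz
    omega

/-! ## §2 Three bookkeeping lemmas: torus-cube membership from an integer window, block offsets, `circAbs` -/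

/-- TORUS-CUBE MEMBERSHIP FROM AN INTEGER WINDOW: if the label of `w_μ` satisfies `0 ≤ w_μ − t_μ − N·m < s` for some integer `m`, then the `μ`-th
condition of `w ∈ torusCube c₀ s` holds for the corner `c₀ μ = t_μ mod N`. [cite: Balaban1985BackgroundPropagators, p.396 (cubes of the torus; bookkeeping)] -/
theorem val_sub_intCast_lt_of_window {s : ℕ} (w : Site (PV d ℓ i.m i.K hd hL) 0) (μ : Fin (PV d ℓ i.m i.K hd hL).d) (t m : ℤ)
    (h0 : 0 ≤ ((w μ).val : ℤ) - t - ((PV d ℓ i.m i.K hd hL).sitesPerDir 0 : ℤ) * m)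
    (hs : ((w μ).val : ℤ) - t - ((PV d ℓ i.m i.K hd hL).sitesPerDir 0 : ℤ) * m < s) :
    (w μ - ((t : ℤ) : ZMod ((PV d ℓ i.m i.K hd hL).sitesPerDir 0))).val < s := by
  obtain ⟨n, hn⟩ := Int.eq_ofNat_of_zero_le h0
  have e : ((((w μ).val : ℤ) - t - ((PV d ℓ i.m i.K hd hL).sitesPerDir 0 : ℤ) * m : ℤ) : ZMod ((PV d ℓ i.m i.K hd hL).sitesPerDir 0))
      = ((n : ℤ) : ZMod ((PV d ℓ i.m i.K hd hL).sitesPerDir 0)) := by rw [hn]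
  push_cast at e
  rw [ZMod.natCast_zmod_val, ZMod.natCast_self, zero_mul, sub_zero] at e
  rw [e, ZMod.val_natCast]
  have hns : n < s := by exact_mod_cast (hn ▸ hs)
  exact lt_of_le_of_lt (Nat.mod_le _ _) hns

/-- THE WINDOW ARITHMETIC behind «□̃⁵ ⊂ one class cube» (all integers): representative within `13S/4` of the centre `(β+½)S` (times `4`), site within `S/8` of
the representative (times `8`), collar within `S` ⇒ the site's label relative to the corner `(β−4)S` lies in `[0, 10S)`.
[cite: Balaban1985BackgroundPropagators, p.409 («□̃⁵ is contained in one of the cubes»; bookkeeping)] -/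
theorem window_arith {S N w z r b m m' : ℤ} (hS : 0 < S)
    (hrep : |4 * r - (4 * b + 2) * S - 4 * (N * m)| ≤ 13 * S) (hz : 8 * |z - r| < S) (hw : |w - z - N * m'| ≤ S) :
    0 ≤ w - (b - 4) * S - N * (m + m') ∧ w - (b - 4) * S - N * (m + m') < 10 * S := by
  have h1 := abs_le.1 hrep
  have h2 := abs_lt.1 (show |z - r| < S from by have := abs_nonneg (z - r); linarith)
  have h2' : 8 * (z - r) < S ∧ -S < 8 * (z - r) := by
    have := abs_le_abs (le_abs_self (z - r)) (neg_le_abs (z - r)); constructor <;> nlinarith [abs_nonneg (z - r), le_abs_self (z - r), neg_abs_le (z - r)]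
  have h3 := abs_le.1 hw
  constructor <;> nlinarith

/-- A SITE IS WITHIN THE BLOCK SIDE OF ITS BLOCK'S REPRESENTATIVE: `|z_μ − x₀(a)_μ| < L^{j(a)}` for `z` in the block `a`.
[cite: Balaban1984PropagatorsII, (2.1) p.224 (the blocks; bookkeeping)] -/
theorem abs_sub_rep_lt_of_blkOf_eq {z : ↥(boxDom (N0 ℓ i.Mh i.k i.P'))} {a : ↥(bset i.D.toDomains)} (hza : blkOf i.D.toDomains z = a)
    (μ : Fin (d + 1)) : |z.1 μ - (rep i.D.toDomains a).1 μ| < (((ℓ + 1) ^ a.1.1 : ℕ) : ℤ) := by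
  have hz := coord_bounds i.D.toDomains hza μ
  have hr := coord_bounds i.D.toDomains (blkOf_rep i.D.toDomains a) μ
  rw [abs_lt]; constructor <;> linarith [hz.1, hz.2, hr.1, hr.2]

/-- a `circAbs` bound is a bound on some translate by the period. [cite: Balaban1984PropagatorsII, (2.2) p.224 (torus distance; bookkeeping)] -/
theorem exists_abs_sub_le_of_circAbs_le {N : ℕ} (hN : 1 ≤ N) {v : ℤ} {r : ℤ} (h : circAbs N v ≤ r) : ∃ m : ℤ, |v - N * m| ≤ r :=
  ⟨-B4TorusKernel.MultiPeriod.centre N v, by rw [mul_neg, sub_neg_eq_add, abs_add_mul_centre hN]; exact h⟩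

end Geometry

/-! ## §3 `□̃(c)` and its collar lie in one cube of print's class -/

section Cover

variable {d ℓ : ℕ} {hd : 1 ≤ d + 1} {hL : Odd (ℓ + 1) ∧ 1 < ℓ + 1} {b₀ b₁ : ℝ} {Mstar : ℕ}
variable (x : MemberY d ℓ hd hL b₀ b₁ Mstar)

/-- THE LABEL WINDOW OF A COLLAR SITE: for a site `z` of `□̃(c)` (`c = (j, β)`, `S = bigSide j`) and a torus site `w` within `circAbs ≤ S` of `z` in the
coordinate `μ`, the label of `w_μ` lies in `[(β_μ − 4)S, (β_μ + 6)S)` modulo the period: `0 ≤ w_μ − (β_μ−4)S − N·m < 10S` for some integer `m`.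
[cite: Balaban1985BackgroundPropagators, p.409 («□̃⁵ is contained in one of the cubes»); Balaban1984PropagatorsII, p.235 («□̃ … of the size 4M»), (2.2) p.224] -/
theorem exists_window_of_mem_cubeDomY_collar (c : ↥(cubes x.toKIdx.D.toDomains)) {z : SiteY x.toKIdx} (hz : z ∈ cubeDomY x c)
    (w : Site (PV d ℓ x.m x.K hd hL) 0) (μ : Fin (PV d ℓ x.m x.K hd hL).d)
    (hw : circAbs ((PV d ℓ x.m x.K hd hL).sitesPerDir 0) (((w μ).val : ℤ) - z.1 μ) ≤ (bigSide ℓ x.Mh c.1.1 : ℤ)) :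
    ∃ m : ℤ, 0 ≤ ((w μ).val : ℤ) - (c.1.2 μ - 4) * (bigSide ℓ x.Mh c.1.1 : ℤ) - ((PV d ℓ x.m x.K hd hL).sitesPerDir 0 : ℤ) * m ∧
      ((w μ).val : ℤ) - (c.1.2 μ - 4) * (bigSide ℓ x.Mh c.1.1 : ℤ) - ((PV d ℓ x.m x.K hd hL).sitesPerDir 0 : ℤ) * m
        < ((10 * bigSide ℓ x.Mh c.1.1 : ℕ) : ℤ) := by
  obtain ⟨S, hSdef⟩ : ∃ S : ℕ, S = bigSide ℓ x.Mh c.1.1 := ⟨_, rfl⟩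
  have h8 : 8 ≤ x.toKIdx.Mh := x.toKIdx.hM8
  have hS : 0 < S := by rw [hSdef]; unfold B6MultiLevelBoxOperator.bigSide; positivity
  have hN1 : 1 ≤ (PV d ℓ x.m x.K hd hL).sitesPerDir 0 := Nat.one_le_iff_ne_zero.2 ((PV d ℓ x.m x.K hd hL).sitesPerDir_ne_zero 0)
  -- the block of `z` lies in `□̃(c)`: level window and representative window
  have hzblk : blkOf x.toKIdx.D.toDomains z ∈ cubeBlksY x c := (Finset.mem_filter.1 hz).2
  have hwin := B6Cover236QbigOverlapV1.window_and_congr_of_mem_QbigT x.toKIdx.D hL (le_trans (by norm_num) h8) x.toKIdx.hR2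
    (one_le_Mh_and_P x.toKIdx).1 (four_le_P x) hzblk
  obtain ⟨⟨-, hlevhi⟩, hrep⟩ := hwin
  obtain ⟨m, hm⟩ := hrep μ
  rw [x.toKIdx.hN μ, ← hSdef] at hm
  -- (a) the representative window, times 4, as an integer inequality
  have hm4 : |(4 : ℝ) * ((((rep x.toKIdx.D.toDomains (blkOf x.toKIdx.D.toDomains z)).1 μ : ℤ) : ℝ) - ((c.1.2 μ : ℝ) + 1 / 2) * (S : ℝ) -
      ((PV d ℓ x.m x.K hd hL).sitesPerDir 0 : ℝ) * (m : ℝ))| ≤ 13 * (S : ℝ) := by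
    rw [abs_mul, abs_of_pos (by norm_num : (0 : ℝ) < 4)]; linarith
  have hmZ : |4 * (rep x.toKIdx.D.toDomains (blkOf x.toKIdx.D.toDomains z)).1 μ - (4 * c.1.2 μ + 2) * (S : ℤ) -
      4 * (((PV d ℓ x.m x.K hd hL).sitesPerDir 0 : ℤ) * m)| ≤ 13 * (S : ℤ) := by
    have h' : |(4 : ℝ) * (((rep x.toKIdx.D.toDomains (blkOf x.toKIdx.D.toDomains z)).1 μ : ℤ) : ℝ) - (4 * (c.1.2 μ : ℝ) + 2) * (S : ℝ) -
        4 * (((PV d ℓ x.m x.K hd hL).sitesPerDir 0 : ℝ) * (m : ℝ))| ≤ 13 * (S : ℝ) := by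
      have e : (4 : ℝ) * (((rep x.toKIdx.D.toDomains (blkOf x.toKIdx.D.toDomains z)).1 μ : ℤ) : ℝ) - (4 * (c.1.2 μ : ℝ) + 2) * (S : ℝ) -
          4 * (((PV d ℓ x.m x.K hd hL).sitesPerDir 0 : ℝ) * (m : ℝ)) =
          (4 : ℝ) * ((((rep x.toKIdx.D.toDomains (blkOf x.toKIdx.D.toDomains z)).1 μ : ℤ) : ℝ) - ((c.1.2 μ : ℝ) + 1 / 2) * (S : ℝ) -
            ((PV d ℓ x.m x.K hd hL).sitesPerDir 0 : ℝ) * (m : ℝ)) := by ring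
      rw [e]; exact hm4
    have h'' : ((|4 * (rep x.toKIdx.D.toDomains (blkOf x.toKIdx.D.toDomains z)).1 μ - (4 * c.1.2 μ + 2) * (S : ℤ) -
        4 * (((PV d ℓ x.m x.K hd hL).sitesPerDir 0 : ℤ) * m)| : ℤ) : ℝ) ≤ ((13 * (S : ℤ) : ℤ) : ℝ) := by
      push_cast; exact h'
    exact_mod_cast h''
  -- (b) the site within the block side of the representative, times 8
  have hzrep := abs_sub_rep_lt_of_blkOf_eq x.toKIdx (a := blkOf x.toKIdx.D.toDomains z) rfl μ
  have hside : 8 * (((ℓ + 1) ^ (blkOf x.toKIdx.D.toDomains z).1.1 : ℕ) : ℤ) ≤ (S : ℤ) := by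
    have h1 : (ℓ + 1) ^ (blkOf x.toKIdx.D.toDomains z).1.1 ≤ (ℓ + 1) ^ (c.1.1 + 1) := Nat.pow_le_pow_right (Nat.succ_pos ℓ) hlevhi
    have h2 : 8 * (ℓ + 1) ^ (c.1.1 + 1) ≤ S := by
      rw [hSdef]; unfold B6MultiLevelBoxOperator.bigSide; exact Nat.mul_le_mul_right _ h8
    exact_mod_cast le_trans (Nat.mul_le_mul_left 8 h1) h2
  have hzZ : 8 * |z.1 μ - (rep x.toKIdx.D.toDomains (blkOf x.toKIdx.D.toDomains z)).1 μ| < (S : ℤ) := by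
    have := abs_nonneg (z.1 μ - (rep x.toKIdx.D.toDomains (blkOf x.toKIdx.D.toDomains z)).1 μ)
    linarith
  -- (c) the collar offset
  have hw' : circAbs ((PV d ℓ x.m x.K hd hL).sitesPerDir 0) (((w μ).val : ℤ) - z.1 μ) ≤ (S : ℤ) := by rw [hSdef]; exact hw
  obtain ⟨m', hm'⟩ := exists_abs_sub_le_of_circAbs_le hN1 hw'
  -- assemble
  have hSZ : (0 : ℤ) < (S : ℤ) := by exact_mod_cast hS
  have key := window_arith hSZ hmZ hzZ hm'
  refine ⟨m + m', ?_, ?_⟩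
  · rw [← hSdef]; exact key.1
  · rw [← hSdef]; push_cast; exact key.2

/-- ★★★ **`□̃(c)` AND ITS COLLAR OF ONE BIG BLOCK LIE IN ONE CUBE OF PRINT'S CLASS** (p. 409: «□̃⁵ is contained in one of the cubes for which (3.35)
holds»): for a cover cube `c = (j, β)` of the member and a threshold `cthr ≤ 10`, the aligned cube `Q` of `10` big `j`-blocks cornered at `(β − 4)·S_j` is a
P-triple of index `j` (size `10`) or `j − 1` (size `10L`), and contains every torus site `w` within torus sup-distance `S_j = bigSide j` (coordinatewise
`circAbs ≤ S_j`) of a site `z` of `□̃(c) = cubeDomY x c`. [cite: Balaban1985BackgroundPropagators, p.409 («□̃⁵ … contained in one of the cubes»), p.396 (the class); Balaban1984PropagatorsII, p.235 («□̃ … of the size 4M»), (2.2) p.224] -/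
theorem exists_cubeClassP_cubeDomY_collar (c : ↥(cubes x.toKIdx.D.toDomains)) {cthr : ℝ} (hc : cthr ≤ 10) :
    ∃ q ∈ cubeClassP x.toKIdx cthr,
      ((q.2.1 = c.1.1 ∧ q.2.2 = 10) ∨ (q.2.1 + 1 = c.1.1 ∧ q.2.2 = 10 * (ℓ + 1))) ∧
      ∀ z ∈ cubeDomY x c, ∀ w : Site (PV d ℓ x.m x.K hd hL) 0,
        (∀ μ, circAbs ((PV d ℓ x.m x.K hd hL).sitesPerDir 0) (((w μ).val : ℤ) - z.1 μ) ≤ (bigSide ℓ x.Mh c.1.1 : ℤ)) → w ∈ q.1 := by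
  classical
  obtain ⟨S, hSdef⟩ : ∃ S : ℕ, S = bigSide ℓ x.Mh c.1.1 := ⟨_, rfl⟩
  have h8 : 8 ≤ x.toKIdx.Mh := x.toKIdx.hM8
  have hS : 0 < S := by rw [hSdef]; unfold B6MultiLevelBoxOperator.bigSide; positivity
  -- the cube has a site of its own level: the witness
  obtain ⟨x₀, hx₀def⟩ : ∃ x₀ : Site (PV d ℓ x.m x.K hd hL) 0, x₀ = (boxEquiv x.toKIdx.hN).symm (wit x.toKIdx.D.toDomains c) := ⟨_, rfl⟩
  have hx₀box : toBox x.toKIdx.hN x₀ = wit x.toKIdx.D.toDomains c := by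
    have := (boxEquiv x.toKIdx.hN).apply_symm_apply (wit x.toKIdx.D.toDomains c)
    rw [hx₀def]; simpa only [boxEquiv_apply] using this
  have hx₀lev : levV1 x.toKIdx x₀ = c.1.1 := by
    show x.toKIdx.D.lev (toBox x.toKIdx.hN x₀).1 = c.1.1
    rw [hx₀box]
    exact lev_wit x.toKIdx.D.toDomains c
  have hjk : c.1.1 ≤ x.toKIdx.k := hx₀lev ▸ levV1_le x.toKIdx x₀
  have hj1 : 1 ≤ c.1.1 := hx₀lev ▸ levV1_pos x.toKIdx x₀
  -- `S ∣ N`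
  have hsN : S ∣ (PV d ℓ x.m x.K hd hL).sitesPerDir 0 := by
    have hNe : (PV d ℓ x.m x.K hd hL).sitesPerDir 0 = bigSide ℓ x.Mh x.k * x.P' 0 := by
      rw [← x.toKIdx.hN 0, B6MultiLevelTorusOperator.N0_eq_bigSide_mul]
    rw [hNe, hSdef]
    exact dvd_mul_of_dvd_left ⟨(ℓ + 1) ^ (x.k - c.1.1), bigSide_eq_mul_pow hjk⟩ _
  -- the corner `(β − 4)·S`, on the big-`j`-grid
  obtain ⟨c₀, hc₀def⟩ : ∃ c₀ : Site (PV d ℓ x.m x.K hd hL) 0,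
      c₀ = fun μ => (((c.1.2 μ - 4) * (S : ℤ) : ℤ) : ZMod ((PV d ℓ x.m x.K hd hL).sitesPerDir 0)) := ⟨_, rfl⟩
  have hc₀ : ∀ μ, S ∣ (c₀ μ).val := by
    intro μ
    have hval : ((c₀ μ).val : ℤ) = ((c.1.2 μ - 4) * (S : ℤ)) % ((PV d ℓ x.m x.K hd hL).sitesPerDir 0 : ℤ) := by
      rw [hc₀def]; exact ZMod.val_intCast _
    have hdvd : (S : ℤ) ∣ ((c₀ μ).val : ℤ) := by
      rw [hval, Int.emod_def]
      exact dvd_sub (dvd_mul_left _ _) (dvd_mul_of_dvd_left (Int.natCast_dvd_natCast.2 hsN) _)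
    exact_mod_cast hdvd
  -- the witness lies in `[βS, (β+1)S) ⊂ Q`
  have hx₀Q : x₀ ∈ torusCube c₀ (10 * S) := by
    intro μ
    have hcoord : (wit x.toKIdx.D.toDomains c).1 μ / (S : ℤ) = c.1.2 μ := by
      have := congrFun (blk_wit x.toKIdx.D.toDomains c) μ
      rw [← hSdef] at this
      exact this
    have hS0 : (0 : ℤ) < (S : ℤ) := by exact_mod_cast hS
    have hlo : (S : ℤ) * c.1.2 μ ≤ (wit x.toKIdx.D.toDomains c).1 μ := by rw [← hcoord]; exact Int.mul_ediv_self_le (ne_of_gt hS0)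
    have hhi : (wit x.toKIdx.D.toDomains c).1 μ < (S : ℤ) * c.1.2 μ + S := by rw [← hcoord]; exact Int.lt_mul_ediv_self_add hS0
    have hval : ((x₀ μ).val : ℤ) = (wit x.toKIdx.D.toDomains c).1 μ := by rw [hx₀def]; exact val_boxEquiv_symm x.toKIdx.hN _ μ
    have e : c₀ μ = (((c.1.2 μ - 4) * (S : ℤ) : ℤ) : ZMod ((PV d ℓ x.m x.K hd hL).sitesPerDir 0)) := by rw [hc₀def]
    rw [e]
    refine val_sub_intCast_lt_of_window x.toKIdx x₀ μ _ 0 ?_ ?_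
    · rw [hval, mul_zero, sub_zero]; nlinarith
    · rw [hval, mul_zero, sub_zero]; push_cast; nlinarith
  rw [hSdef] at hc₀ hx₀Q
  have hP := alignedTenCube_mem_cubeClassP_or x.toKIdx hc hj1 hjk c₀ hc₀ hx₀Q hx₀lev
  -- the collar lies in `Q`
  have hcollar : ∀ z ∈ cubeDomY x c, ∀ w : Site (PV d ℓ x.m x.K hd hL) 0,
      (∀ μ, circAbs ((PV d ℓ x.m x.K hd hL).sitesPerDir 0) (((w μ).val : ℤ) - z.1 μ) ≤ (bigSide ℓ x.Mh c.1.1 : ℤ)) →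
        w ∈ torusCube c₀ (10 * S) := by
    intro z hz w hw μ
    obtain ⟨m, h0, h10⟩ := exists_window_of_mem_cubeDomY_collar x c hz w μ (hw μ)
    rw [← hSdef] at h0 h10
    have e : c₀ μ = (((c.1.2 μ - 4) * (S : ℤ) : ℤ) : ZMod ((PV d ℓ x.m x.K hd hL).sitesPerDir 0)) := by rw [hc₀def]
    rw [e]
    exact val_sub_intCast_lt_of_window x.toKIdx w μ _ m h0 h10
  rw [hSdef] at hcollar
  rcases hP with hP | hP
  · exact ⟨_, hP, Or.inl ⟨rfl, rfl⟩, hcollar⟩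
  · exact ⟨_, hP, Or.inr ⟨by simp only; omega, rfl⟩, hcollar⟩

/-- `□̃(c)` ITSELF lies in the covering class cube (the collar condition at distance `0`). [cite: Balaban1985BackgroundPropagators, p.409 («□̃⁵ is contained in one of the cubes»)] -/
theorem cubeDomY_subset_cubeClassP (c : ↥(cubes x.toKIdx.D.toDomains)) {cthr : ℝ} (hc : cthr ≤ 10) :
    ∃ q ∈ cubeClassP x.toKIdx cthr, ((q.2.1 = c.1.1 ∧ q.2.2 = 10) ∨ (q.2.1 + 1 = c.1.1 ∧ q.2.2 = 10 * (ℓ + 1))) ∧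
      ∀ z ∈ cubeDomY x c, (boxEquiv x.toKIdx.hN).symm z ∈ q.1 := by
  obtain ⟨q, hq, hidx, hcollar⟩ := exists_cubeClassP_cubeDomY_collar x c hc
  refine ⟨q, hq, hidx, fun z hz => hcollar z hz _ fun μ => ?_⟩
  rw [val_boxEquiv_symm x.toKIdx.hN z μ, sub_self]
  unfold B4TorusKernel.MultiPeriod.circAbs
  simp only [Int.zero_emod, sub_zero]
  exact le_trans (min_le_left _ _) (Int.natCast_nonneg _)

end Cover

/-! ## §4 The (3.35) datum — one gauge, one small field — on the whole collar of `□̃(c)` -/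

section Datum

variable {d ℓ : ℕ} {hd : 1 ≤ d + 1} {hL : Odd (ℓ + 1) ∧ 1 < ℓ + 1} {b₀ b₁ : ℝ} {Mstar : ℕ}
variable {𝔸 : Type} [NormedRing 𝔸] [NormedAlgebra ℂ 𝔸] [CompleteSpace 𝔸] {G : Subgroup 𝔸ˣ}
variable (x : MemberY d ℓ hd hL b₀ b₁ Mstar)

/-- the (3.35) datum read off a P-triple that is EITHER `(Q, j, 10)` OR `(Q, j−1, 10L)`, on any sub-set of `Q`, at the scale `Lʲη` with the constant
`10L³·(M·α₀)` — the bridge's two conversions packaged for §3's disjunction. [cite: Balaban1985BackgroundPropagators, (3.35) p.396] -/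
theorem reg335Cube_of_cover_or (i : KIdx d ℓ hd hL b₀ b₁) {cthr α₀ : ℝ} (hα : 0 ≤ α₀) {U : CfgV1 (PV d ℓ i.m i.K hd hL) 𝔸}
    (h : (bg9KP 𝔸 G i).Reg335 cthr α₀ U) {q : Set (Site (PV d ℓ i.m i.K hd hL) 0) × ℕ × ℕ} (hq : q ∈ cubeClassP i cthr) {j : ℕ}
    (hcase : (q.2.1 = j ∧ q.2.2 = 10) ∨ (q.2.1 + 1 = j ∧ q.2.2 = 10 * (ℓ + 1))) {W : Set (Site (PV d ℓ i.m i.K hd hL) 0)} (hW : W ⊆ q.1) :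
    Reg335Cube (shiftsV1 (PV d ℓ i.m i.K hd hL)) U (kGeo i).eta W (scaleLen (kGeo i).L (kGeo i).eta j) (10 * (kGeo i).L ^ 3 * ((kGeo i).M * α₀)) := by
  obtain ⟨hη, hL1, hM⟩ := eta_pos_L_one_le_M_pos i
  have hMα : 0 ≤ (kGeo i).M * α₀ := mul_nonneg hM.le hα
  have hL0 : 0 < (kGeo i).L := lt_of_lt_of_le one_pos hL1
  have hdat := reg335CubeP_of_reg335P_subset (𝔸 := 𝔸) (G := G) i h hq hW
  rcases hcase with ⟨hj, hn⟩ | ⟨hj, hn⟩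
  · rw [hj, hn] at hdat
    refine reg335Cube_mono_const (le_of_lt (LatticeNorms.scaleLen_pos hL0 hη _)) ?_ hdat
    have h1 : (1 : ℝ) ≤ (kGeo i).L ^ 3 := one_le_pow₀ hL1
    simp only [Nat.cast_ofNat]
    nlinarith [mul_nonneg (sub_nonneg.2 h1) hMα]
  · rw [hn] at hdat
    rw [← hj, scaleLen_succ']
    have hsc := reg335Cube_scale_up (shiftsV1 (PV d ℓ i.m i.K hd hL)) U (t := (kGeo i).L) hL1 (LatticeNorms.scaleLen_pos hL0 hη q.2.1)
      (mul_nonneg (by positivity) hMα) hdat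
    refine reg335Cube_mono_const (mul_nonneg hL0.le (le_of_lt (LatticeNorms.scaleLen_pos hL0 hη q.2.1))) (le_of_eq ?_) hsc
    push_cast
    ring

/-- ★★ **(3.35) ON THE COLLAR OF `□̃(c)`, FROM PRINT'S CLASS**: for `U` in `(bg9KP 𝔸 G x.toKIdx).Reg335 cthr α₀` (`cthr ≤ 10`, `α₀ ≥ 0`) there are ONE gauge
`u` and ONE field `A` with `U^u = e^{iηA}` and `|A| < C·(Lʲη)⁻¹`, `|∇^ηA| < C·(Lʲη)⁻²`, `C = 10L³·(M·α₀)`, on the whole collar of `□̃(c)` (all torus sites within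
`bigSide j` of `cubeDomY x c`, `j = j(c)`) — r06's datum `Reg335Cube` there, at the scale `L^{j(c)}η`: the covering P-triple of §3 carries it at the scale
`L^{j′}η`, `j′ ∈ {j, j−1}`, and the bridge's conversions bring it to `Lʲη` at the cost `L²`. [cite: Balaban1985BackgroundPropagators, (3.35) p.396, p.409 («□̃⁵ … one of the cubes»), p.416 («the gauge in which U = e^{iηA}, A small»)] -/
theorem reg335Cube_cubeDomY_collar_of_reg335P (c : ↥(cubes x.toKIdx.D.toDomains)) {cthr α₀ : ℝ} (hc : cthr ≤ 10) (hα : 0 ≤ α₀)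
    {U : CfgV1 (PV d ℓ x.m x.K hd hL) 𝔸} (h : (bg9KP 𝔸 G x.toKIdx).Reg335 cthr α₀ U) :
    Reg335Cube (shiftsV1 (PV d ℓ x.m x.K hd hL)) U (kGeo x.toKIdx).eta
      {w | ∃ z ∈ cubeDomY x c, ∀ μ, circAbs ((PV d ℓ x.m x.K hd hL).sitesPerDir 0) (((w μ).val : ℤ) - z.1 μ) ≤ (bigSide ℓ x.Mh c.1.1 : ℤ)}
      (scaleLen (kGeo x.toKIdx).L (kGeo x.toKIdx).eta c.1.1) (10 * (kGeo x.toKIdx).L ^ 3 * ((kGeo x.toKIdx).M * α₀)) := by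
  obtain ⟨q, hqP, hcase, hcollar⟩ := exists_cubeClassP_cubeDomY_collar x c hc
  refine reg335Cube_of_cover_or x.toKIdx hα h hqP hcase ?_
  rintro w ⟨z, hz, hw⟩
  exact hcollar z hz w hw

/-- ★★ **MEMBER FORM** (def-Y's `bg9YP`, first sequence `{Ω_j}`): the (3.35) datum on the collar of `□̃(c)` at the scale `L^{j(c)}η`, constant `10L³·(M·α₀)`.
[cite: Balaban1985BackgroundPropagators, (3.35) p.396, p.409, p.416] -/
theorem reg335Cube_cubeDomY_collar_of_regYP335 (c : ↥(cubes x.toKIdx.D.toDomains)) {cthr α₀ : ℝ} (hc : cthr ≤ 10) (hα : 0 ≤ α₀)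
    {U : CfgV1 (PV d ℓ x.m x.K hd hL) 𝔸} (h : (bg9YP 𝔸 G x).Reg335 cthr α₀ U) :
    Reg335Cube (shiftsV1 (PV d ℓ x.m x.K hd hL)) U (kGeo x.toKIdx).eta
      {w | ∃ z ∈ cubeDomY x c, ∀ μ, circAbs ((PV d ℓ x.m x.K hd hL).sitesPerDir 0) (((w μ).val : ℤ) - z.1 μ) ≤ (bigSide ℓ x.Mh c.1.1 : ℤ)}
      (scaleLen (kGeo x.toKIdx).L (kGeo x.toKIdx).eta c.1.1) (10 * (kGeo x.toKIdx).L ^ 3 * ((kGeo x.toKIdx).M * α₀)) :=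
  reg335Cube_cubeDomY_collar_of_reg335P x c hc hα h.1

/-- ★ the member form at the N06 certificate's literal threshold letter `c35Y` (MODULE 4; `= 10`).
[cite: Balaban1985BackgroundPropagators, (3.35) p.396 («≧ 10»), p.409] -/
theorem reg335Cube_cubeDomY_collar_of_regYP335_c35Y (c : ↥(cubes x.toKIdx.D.toDomains)) {α₀ : ℝ} (hα : 0 ≤ α₀)
    {U : CfgV1 (PV d ℓ x.m x.K hd hL) 𝔸} (h : (bg9YP 𝔸 G x).Reg335 B9PinGeometryKLevelV1.c35Y α₀ U) :
    Reg335Cube (shiftsV1 (PV d ℓ x.m x.K hd hL)) U (kGeo x.toKIdx).eta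
      {w | ∃ z ∈ cubeDomY x c, ∀ μ, circAbs ((PV d ℓ x.m x.K hd hL).sitesPerDir 0) (((w μ).val : ℤ) - z.1 μ) ≤ (bigSide ℓ x.Mh c.1.1 : ℤ)}
      (scaleLen (kGeo x.toKIdx).L (kGeo x.toKIdx).eta c.1.1) (10 * (kGeo x.toKIdx).L ^ 3 * ((kGeo x.toKIdx).M * α₀)) :=
  reg335Cube_cubeDomY_collar_of_regYP335 x c (by norm_num [B9PinGeometryKLevelV1.c35Y]) hα h

end Datum

end Literature.MathematicalPhysics.QuantumFieldTheory.Balaban1983to89.B9Eq335CubeDomCoverP
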